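/-
Origin: expansion seat `planner-pub-hodgecm-pv14-g6-0`, handover import Pv14g6.SchwartzWeilUnipotent -> import HodgeCM.Automorphic.SchwartzWeilUnipotent ; after SchwartzWeilUnipotent (this seat row 2, same run) (`HOME/pub-hodgecm-pv14-g6/lean/Pv14g6/SchwartzWeilThetaParabolic.lean`, md5 2ac6c2df, 260 lines);
landed by the gen-8 packager in gate run 30 as `HodgeCM/Automorphic/SchwartzWeilThetaParabolic.lean` (import ^import Pv14g6\.SchwartzWeilUnipotent[ \t]*$→import HodgeCM.Automorphic.SchwartzWeilUnipotent ×1).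
-/
/-
Origin: `pub-hodgecm-pv14-g6/lean/Pv14g6/SchwartzWeilThetaParabolic.lean` — session planner-pub-hodgecm-pv14-g6-0
(unit pub-hodgecm-pv14-g6, DAG-node prover #14, gen 6).  Intended final place:
`HodgeCM/Automorphic/SchwartzWeilThetaParabolic.lean` (namespace `HodgeCM.SchwartzWeil`).  NEW ADDITIVE LEAF.
PACKAGER: rewrite `import Pv14g6.SchwartzWeilUnipotent` to `import HodgeCM.Automorphic.SchwartzWeilUnipotent`.
Asserts nothing: no axioms, no unproved declarations.
-/
import Summits.HodgeConjecture.HodgeCM.Automorphic.SchwartzWeilUnipotent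

/-!
# Theta on the Heisenberg group under the intertwining group: the integral Siegel parabolic

The landed `WeilThetaModelHeisenberg` proves `Θ_Φ(γ h) = Θ_Φ(h)` for `γ` in Weil's arithmetic subgroup `arith`
(LEFT invariance in `h`) and `SchwartzChirp` adds `Θ_{T_k Φ}(1) = Θ_Φ(1)` for the integral scalar chirps.  This file
treats the OPERATOR side uniformly through the intertwining group `Mp_m(V)` of `SchwartzWeilProjective`:

* **transformation law** (`thetaH_of_mem_mpGroup`): if `(γ, R) ∈ Mp_m(V)` and `R` fixes the lattice functional
  `Ψ ↦ Θ_Ψ(1) = Σ_{v ∈ L} Ψ(v)`, then `Θ_{R Φ}(h) = Θ_Φ(γ⁻¹ h)` for ALL `h` — the modular behaviour of theta under an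
  element of the "integral metaplectic group" is read off from its action on the Heisenberg variable;
* **the Levi factor** (`SchwartzWeilLevi`): for `A ∈ GL(V)` with `A L = L` the dilation `L_A` fixes the lattice functional
  (`tsum_leviCLM`), so `Θ_{L_A Φ}(h) = Θ_Φ(λ_{A⁻¹} h)` (`thetaH_leviCLM`), and `λ_A` preserves `arith` (`leviAut_mem_arith`);
* **the unipotent radical** (`SchwartzWeilUnipotent`): for a symmetric `Q` with `⟪Q v, v⟫ ∈ 2ℤ` on `L` the chirp `T_Q`
  fixes the lattice functional (`tsum_chirpQ`), so `Θ_{T_{mQ} Φ}(h) = Θ_Φ(n_{-Q} h)` (`thetaH_chirpQ`); and `n_Q` preserves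
  `arith` when moreover `m Q L ⊆ L*` (`unipQ_mem_arith`).

Together with the landed Weyl element (Poisson summation, `WeilThetaModelHeisenbergWeyl`) these are the generators of the
integral points of the Siegel parabolic acting on Weil's theta functions [We64 n° 41, n° 49–51].

## References

* A. Weil, *Sur certains groupes d'opérateurs unitaires*, Acta Math. 111 (1964), n° 41, n° 49–51.
* D. Mumford, *Tata lectures on theta I* (1983), §II.5 (the functional equation under the integral parabolic).
-/

noncomputable section

open scoped SchwartzMap RealInnerProductSpace FourierTransform

namespace HodgeCM
namespace SchwartzWeil

/-! ## The transformation law under the intertwining group -/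

section General

variable (V : Type) [NormedAddCommGroup V] [InnerProductSpace ℝ V] [FiniteDimensional ℝ V] [MeasurableSpace V]
  [BorelSpace V] (L : Submodule ℤ V) (m : ℤ)

/-- The general value through the base point: `Θ_Φ(h) = Θ_{ρ_m(h) Φ}(1)`. -/
theorem thetaH_eq_thetaH_repCLM_one (Φ : 𝓢(V, ℂ)) (h : Heis V) :
    thetaH V L m Φ h = thetaH V L m (repCLM V m h Φ) 1 := by
  rw [thetaH_repCLM, one_mul]

/-- Membership in `Mp_m(V)` as the commutation rule `ρ_m(h) ∘ R = R ∘ ρ_m(γ⁻¹ h)`. -/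
theorem repCLM_apply_of_mem_mpGroup {γ : MulAut (Heis V)} {R : (𝓢(V, ℂ) →L[ℂ] 𝓢(V, ℂ))ˣ}
    (hmem : (γ, R) ∈ mpGroup V m) (h : Heis V) (Φ : 𝓢(V, ℂ)) :
    repCLM V m h ((R : 𝓢(V, ℂ) →L[ℂ] 𝓢(V, ℂ)) Φ) =
      (R : 𝓢(V, ℂ) →L[ℂ] 𝓢(V, ℂ)) (repCLM V m (γ⁻¹ h) Φ) := by
  have h1 : repUnits V m h * R = R * repUnits V m (γ⁻¹ h) := by
    rw [← eq_mul_inv_iff_mul_eq, ← hmem (γ⁻¹ h), MulAut.apply_inv_self]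
  have h2 := congrArg (fun U : (𝓢(V, ℂ) →L[ℂ] 𝓢(V, ℂ))ˣ => (U : 𝓢(V, ℂ) →L[ℂ] 𝓢(V, ℂ)) Φ) h1
  simpa only [Units.val_mul, val_repUnits, ContinuousLinearMap.mul_def, ContinuousLinearMap.comp_apply] using h2

/-- **Transformation law of theta under the intertwining group.**  If `(γ, R) ∈ Mp_m(V)` and `R` fixes the lattice
functional `Ψ ↦ Θ_Ψ(1)`, then `Θ_{R Φ}(h) = Θ_Φ(γ⁻¹ h)` for every `h ∈ Heis V`. -/
theorem thetaH_of_mem_mpGroup {γ : MulAut (Heis V)} {R : (𝓢(V, ℂ) →L[ℂ] 𝓢(V, ℂ))ˣ} (hmem : (γ, R) ∈ mpGroup V m)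
    (hR : ∀ Ψ : 𝓢(V, ℂ), thetaH V L m ((R : 𝓢(V, ℂ) →L[ℂ] 𝓢(V, ℂ)) Ψ) 1 = thetaH V L m Ψ 1) (Φ : 𝓢(V, ℂ))
    (h : Heis V) : thetaH V L m ((R : 𝓢(V, ℂ) →L[ℂ] 𝓢(V, ℂ)) Φ) h = thetaH V L m Φ (γ⁻¹ h) := by
  rw [thetaH_eq_thetaH_repCLM_one V L m _ h, repCLM_apply_of_mem_mpGroup V m hmem, hR,
    ← thetaH_eq_thetaH_repCLM_one]

/-- The same for an intertwining lift `(φ, π)` of a group `D`: `Θ_{π(d) Φ}(h) = Θ_Φ(φ(d⁻¹) h)`. -/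
theorem Intertwines.thetaH_apply {D : Type} [Group D] {φ : D →* MulAut (Heis V)}
    {π : D →* (𝓢(V, ℂ) →L[ℂ] 𝓢(V, ℂ))ˣ} (hc : Intertwines V m φ π) {d : D}
    (hd : ∀ Ψ : 𝓢(V, ℂ), thetaH V L m ((π d : 𝓢(V, ℂ) →L[ℂ] 𝓢(V, ℂ)) Ψ) 1 = thetaH V L m Ψ 1) (Φ : 𝓢(V, ℂ))
    (h : Heis V) : thetaH V L m ((π d : 𝓢(V, ℂ) →L[ℂ] 𝓢(V, ℂ)) Φ) h = thetaH V L m Φ (φ d⁻¹ h) := by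
  rw [map_inv]
  exact thetaH_of_mem_mpGroup V L m (hc d) hd Φ h

/-- With `γ` moreover normalising `arith`, the transformed theta function keeps its arithmetic invariance in the
expected form: `Θ_{R Φ}(γ(δ) h) = Θ_{R Φ}(h)` for `δ ∈ arith`. -/
theorem thetaH_of_mem_mpGroup_arith {γ : MulAut (Heis V)} {R : (𝓢(V, ℂ) →L[ℂ] 𝓢(V, ℂ))ˣ}
    (hmem : (γ, R) ∈ mpGroup V m)
    (hR : ∀ Ψ : 𝓢(V, ℂ), thetaH V L m ((R : 𝓢(V, ℂ) →L[ℂ] 𝓢(V, ℂ)) Ψ) 1 = thetaH V L m Ψ 1) (Φ : 𝓢(V, ℂ))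
    {δ : Heis V} (hδ : δ ∈ arith V L m) (h : Heis V) :
    thetaH V L m ((R : 𝓢(V, ℂ) →L[ℂ] 𝓢(V, ℂ)) Φ) (γ δ * h) = thetaH V L m ((R : 𝓢(V, ℂ) →L[ℂ] 𝓢(V, ℂ)) Φ) h := by
  rw [thetaH_of_mem_mpGroup V L m hmem hR, thetaH_of_mem_mpGroup V L m hmem hR, map_mul, MulAut.inv_apply_self,
    thetaH_arith_mul V L m Φ hδ]

end General

/-! ## Lattice bookkeeping: `GL(L)`, `L`-even symmetric operators -/

section Lattice

variable (V : Type) [NormedAddCommGroup V] [InnerProductSpace ℝ V] (L : Submodule ℤ V) (m : ℤ)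

/-- An automorphism of `V` preserving `L` permutes `L`. -/
def latticeEquivOfPreserves (A : V ≃L[ℝ] V) (hA : ∀ v : V, A v ∈ L ↔ v ∈ L) : L ≃ L where
  toFun v := ⟨A.symm (v : V), (hA _).1 (by simpa only [ContinuousLinearEquiv.apply_symm_apply] using v.2)⟩
  invFun v := ⟨A (v : V), (hA _).2 v.2⟩
  left_inv v := Subtype.ext (A.apply_symm_apply (v : V))
  right_inv v := Subtype.ext (A.symm_apply_apply (v : V))

/-- (Ported verbatim from the HodgeCMPerL package; no docstring in the source.) -/
@[simp] theorem coe_latticeEquivOfPreserves (A : V ≃L[ℝ] V) (hA : ∀ v : V, A v ∈ L ↔ v ∈ L) (v : L) :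
    (latticeEquivOfPreserves V L A hA v : V) = A.symm (v : V) := rfl

/-- (Ported verbatim from the HodgeCMPerL package; no docstring in the source.) -/
theorem preserves_inv (A : V ≃L[ℝ] V) (hA : ∀ v : V, A v ∈ L ↔ v ∈ L) (v : V) : A⁻¹ v ∈ L ↔ v ∈ L := by
  rw [← hA (A⁻¹ v), show A (A⁻¹ v) = v from A.apply_symm_apply v]

/-- **The dilation by `A ∈ GL(L)` fixes the lattice functional**: `Σ_{v ∈ L} Φ(A⁻¹ v) = Σ_{v ∈ L} Φ(v)`. -/
theorem tsum_leviCLM (A : V ≃L[ℝ] V) (hA : ∀ v : V, A v ∈ L ↔ v ∈ L) (Φ : 𝓢(V, ℂ)) :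
    ∑' v : L, leviCLM V A Φ (v : V) = ∑' v : L, Φ (v : V) := by
  simp only [leviCLM_apply]
  exact Equiv.tsum_eq (latticeEquivOfPreserves V L A hA) (fun w : L => Φ (w : V))

/-- **An `L`-even symmetric chirp fixes the lattice functional**: `Σ_{v ∈ L} 𝐞(⟪Q v, v⟫/2) Φ(v) = Σ_{v ∈ L} Φ(v)` when
`⟪Q v, v⟫/2 ∈ ℤ` on `L`. -/
theorem tsum_chirpQ (Q : V →L[ℝ] V) (hQ : ∀ v ∈ L, ∃ k : ℤ, (k : ℝ) = ⟪Q v, v⟫ / 2) (Φ : 𝓢(V, ℂ)) :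
    ∑' v : L, chirpQ V Q Φ (v : V) = ∑' v : L, Φ (v : V) := by
  refine tsum_congr fun v => ?_
  obtain ⟨k, hk⟩ := hQ v v.2
  rw [chirpQ_apply, ← hk, PoissonSummation.fourierChar_intCast, Circle.coe_one, one_mul]

/-- The evenness condition scales: `⟪(mQ) v, v⟫/2 = m⟪Q v, v⟫/2`. -/
theorem even_smul (Q : V →L[ℝ] V) (hQ : ∀ v ∈ L, ∃ k : ℤ, (k : ℝ) = m * ⟪Q v, v⟫ / 2) :
    ∀ v ∈ L, ∃ k : ℤ, (k : ℝ) = ⟪((m : ℝ) • Q) v, v⟫ / 2 := by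
  intro v hv
  obtain ⟨k, hk⟩ := hQ v hv
  exact ⟨k, by rw [hk, smul_apply, real_inner_smul_left]⟩

/-- (Ported verbatim from the HodgeCMPerL package; no docstring in the source.) -/
theorem even_neg (Q : V →L[ℝ] V) (hQ : ∀ v ∈ L, ∃ k : ℤ, (k : ℝ) = m * ⟪Q v, v⟫ / 2) :
    ∀ v ∈ L, ∃ k : ℤ, (k : ℝ) = m * ⟪(-Q) v, v⟫ / 2 := by
  intro v hv
  obtain ⟨k, hk⟩ := hQ v hv
  exact ⟨-k, by rw [neg_apply, inner_neg_left]; push_cast; rw [hk]; ring⟩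

/-- **`n_Q` preserves Weil's arithmetic subgroup** when `m Q L ⊆ L*` and `m⟪Q v, v⟫ ∈ 2ℤ` on `L`. -/
theorem unipQ_mem_arith (Q : symOp V)
    (hQL : ∀ v ∈ L, (m : ℝ) • (Q : V →L[ℝ] V) v ∈ PoissonSummation.dualLattice L)
    (hQ : ∀ v ∈ L, ∃ k : ℤ, (k : ℝ) = m * ⟪(Q : V →L[ℝ] V) v, v⟫ / 2) {h : Heis V} (hh : h ∈ arith V L m) :
    Heis.unipQ Q h ∈ arith V L m := by
  obtain ⟨ha, hb, hu⟩ := hh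
  obtain ⟨k, hk⟩ := hQ h.a ha
  refine ⟨ha, ?_, ?_⟩
  · rw [Heis.unipQ_apply, Heis.unipQFun_b, smul_add]
    exact (PoissonSummation.dualLattice L).add_mem hb (hQL h.a ha)
  · rw [Heis.unipQ_apply, Heis.unipQFun_u, mul_zpow, hu, one_mul, ← AddChar.map_zsmul_eq_zpow,
      show m • (-(⟪(Q : V →L[ℝ] V) h.a, h.a⟫ / 2)) = ((-k : ℤ) : ℝ) by rw [zsmul_eq_mul]; push_cast; rw [hk]; ring,
      PoissonSummation.fourierChar_intCast]

/-- … so does `n_{-Q}`. -/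
theorem unipQ_neg_mem_arith (Q : symOp V)
    (hQL : ∀ v ∈ L, (m : ℝ) • (Q : V →L[ℝ] V) v ∈ PoissonSummation.dualLattice L)
    (hQ : ∀ v ∈ L, ∃ k : ℤ, (k : ℝ) = m * ⟪(Q : V →L[ℝ] V) v, v⟫ / 2) {h : Heis V} (hh : h ∈ arith V L m) :
    Heis.unipQ (-Q) h ∈ arith V L m := by
  refine unipQ_mem_arith V L m (-Q) (fun v hv => ?_) (even_neg V L m _ hQ) hh
  simpa only [Submodule.coe_neg, neg_apply, smul_neg] using
    (PoissonSummation.dualLattice L).neg_mem (hQL v hv)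

/-- For an INTEGRAL lattice (`L ≤ L*`) the scalar `Q = (2k) • 1`, `k ∈ ℤ`, is `L`-even in every weight: this recovers
the landed `unip_mem_arith` / `thetaH_chirpCLM_one_of_le` through `Heis.unip_eq_unipQ` / `chirpCLM_eq_chirpQ`. -/
theorem even_two_mul_int_smul_one (hL : L ≤ PoissonSummation.dualLattice L) (k : ℤ) :
    ∀ v ∈ L, ∃ k' : ℤ, (k' : ℝ) = m * ⟪((2 * (k : ℝ)) • (1 : V →L[ℝ] V)) v, v⟫ / 2 := by
  intro v hv
  obtain ⟨n, hn⟩ := exists_int_eq_norm_sq_of_le_dualLattice V L hL hv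
  refine ⟨m * k * n, ?_⟩
  rw [smul_apply, one_apply_eq_self, real_inner_smul_left, real_inner_self_eq_norm_sq, ← hn]
  push_cast
  ring

variable [FiniteDimensional ℝ V]

/-- `ᵗA⁻¹` maps `L*` to `L*` when `A` preserves `L`. -/
theorem contragredient_mem_dualLattice (A : V ≃L[ℝ] V) (hA : ∀ v : V, A v ∈ L ↔ v ∈ L) {w : V}
    (hw : w ∈ PoissonSummation.dualLattice L) : Heis.contragredient A w ∈ PoissonSummation.dualLattice L := by
  rw [PoissonSummation.mem_dualLattice] at hw ⊢
  intro v hv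
  rw [Heis.inner_contragredient_left]
  exact hw (A.symm v) ((hA _).1 (by simpa only [ContinuousLinearEquiv.apply_symm_apply] using hv))

/-- **`λ_A` preserves Weil's arithmetic subgroup** for `A ∈ GL(L)`. -/
theorem leviAut_mem_arith (A : V ≃L[ℝ] V) (hA : ∀ v : V, A v ∈ L ↔ v ∈ L) {h : Heis V} (hh : h ∈ arith V L m) :
    Heis.leviAut A h ∈ arith V L m := by
  obtain ⟨ha, hb, hu⟩ := hh
  refine ⟨(hA _).2 ha, ?_, hu⟩
  rw [Heis.leviAut_apply]
  change (m : ℝ) • Heis.contragredient A h.b ∈ PoissonSummation.dualLattice L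
  rw [← map_smul]
  exact contragredient_mem_dualLattice V L A hA hb

end Lattice

/-! ## Theta under the integral Levi factor and the integral unipotent radical -/

section Parabolic

variable (V : Type) [NormedAddCommGroup V] [InnerProductSpace ℝ V] [FiniteDimensional ℝ V] [MeasurableSpace V]
  [BorelSpace V] (L : Submodule ℤ V) (m : ℤ)

/-- `Θ_{L_A Φ}(1) = Θ_Φ(1)` for `A ∈ GL(L)`. -/
theorem thetaH_leviCLM_one (A : V ≃L[ℝ] V) (hA : ∀ v : V, A v ∈ L ↔ v ∈ L) (Φ : 𝓢(V, ℂ)) :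
    thetaH V L m (leviCLM V A Φ) 1 = thetaH V L m Φ 1 := by
  rw [thetaH_one, thetaH_one, tsum_leviCLM V L A hA Φ]

/-- **Theta under the integral Levi factor**: `Θ_{L_A Φ}(h) = Θ_Φ(λ_{A⁻¹} h)` for `A ∈ GL(L)`, all `h`. -/
theorem thetaH_leviCLM (A : V ≃L[ℝ] V) (hA : ∀ v : V, A v ∈ L ↔ v ∈ L) (Φ : 𝓢(V, ℂ)) (h : Heis V) :
    thetaH V L m (leviCLM V A Φ) h = thetaH V L m Φ (Heis.leviAut A⁻¹ h) := by
  have h1 := thetaH_of_mem_mpGroup V L m (levi_mem_mpGroup V m A) (thetaH_leviCLM_one V L m A hA) Φ h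
  rwa [val_leviUnit, ← map_inv] at h1

/-- Hence `Θ_{L_A Φ}` is again `arith`-invariant on the left. -/
theorem thetaH_leviCLM_arith_mul (A : V ≃L[ℝ] V) (hA : ∀ v : V, A v ∈ L ↔ v ∈ L) (Φ : 𝓢(V, ℂ)) {δ : Heis V}
    (hδ : δ ∈ arith V L m) (h : Heis V) :
    thetaH V L m (leviCLM V A Φ) (δ * h) = thetaH V L m (leviCLM V A Φ) h := by
  rw [thetaH_leviCLM V L m A hA, thetaH_leviCLM V L m A hA, map_mul]
  exact thetaH_arith_mul V L m Φ (leviAut_mem_arith V L m A⁻¹ (preserves_inv V L A hA) hδ) _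

/-- `Θ_{T_Q Φ}(1) = Θ_Φ(1)` for an `L`-even `Q`. -/
theorem thetaH_chirpQ_one (Q : V →L[ℝ] V) (hQ : ∀ v ∈ L, ∃ k : ℤ, (k : ℝ) = ⟪Q v, v⟫ / 2) (Φ : 𝓢(V, ℂ)) :
    thetaH V L m (chirpQ V Q Φ) 1 = thetaH V L m Φ 1 := by
  rw [thetaH_one, thetaH_one, tsum_chirpQ V L Q hQ Φ]

/-- **Theta under the integral unipotent radical**: `Θ_{T_{mQ} Φ}(h) = Θ_Φ(n_{-Q} h)` for a symmetric `Q` with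
`m⟪Q v, v⟫ ∈ 2ℤ` on `L`, all `h`. -/
theorem thetaH_chirpQ (Q : symOp V) (hQ : ∀ v ∈ L, ∃ k : ℤ, (k : ℝ) = m * ⟪(Q : V →L[ℝ] V) v, v⟫ / 2)
    (Φ : 𝓢(V, ℂ)) (h : Heis V) :
    thetaH V L m (chirpQ V ((m : ℝ) • (Q : V →L[ℝ] V)) Φ) h = thetaH V L m Φ (Heis.unipQ (-Q) h) := by
  have h1 := thetaH_of_mem_mpGroup V L m (unipQ_mem_mpGroup V m Q)
    (thetaH_chirpQ_one V L m _ (even_smul V L m _ hQ)) Φ h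
  rwa [val_chirpQHom, toAdd_ofAdd, ← Heis.unipQ_neg] at h1

/-- Hence `Θ_{T_{mQ} Φ}` is again `arith`-invariant on the left (under both hypotheses). -/
theorem thetaH_chirpQ_arith_mul (Q : symOp V)
    (hQL : ∀ v ∈ L, (m : ℝ) • (Q : V →L[ℝ] V) v ∈ PoissonSummation.dualLattice L)
    (hQ : ∀ v ∈ L, ∃ k : ℤ, (k : ℝ) = m * ⟪(Q : V →L[ℝ] V) v, v⟫ / 2) (Φ : 𝓢(V, ℂ)) {δ : Heis V}
    (hδ : δ ∈ arith V L m) (h : Heis V) :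
    thetaH V L m (chirpQ V ((m : ℝ) • (Q : V →L[ℝ] V)) Φ) (δ * h) =
      thetaH V L m (chirpQ V ((m : ℝ) • (Q : V →L[ℝ] V)) Φ) h := by
  rw [thetaH_chirpQ V L m Q hQ, thetaH_chirpQ V L m Q hQ, map_mul]
  exact thetaH_arith_mul V L m Φ (unipQ_neg_mem_arith V L m Q hQL hQ hδ) _

/-- The integral scalar case, through the general one: `Θ_{T_{mk} Φ}(h) = Θ_Φ(n_{-2k} h)` for an integral lattice
and `k ∈ ℤ` (cf. the landed `thetaH_chirpCLM`, `thetaH_chirpCLM_one_of_le`). -/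
theorem thetaH_chirpCLM_int (hL : L ≤ PoissonSummation.dualLattice L) (k : ℤ) (Φ : 𝓢(V, ℂ)) (h : Heis V) :
    thetaH V L m (chirpCLM V (m * k) Φ) h = thetaH V L m Φ (Heis.unip (-(2 * (k : ℝ))) h) := by
  have h1 := thetaH_chirpQ V L m ⟨(2 * (k : ℝ)) • 1, smul_one_mem_symOp V _⟩
    (even_two_mul_int_smul_one V L m hL k) Φ h
  rw [show ((m : ℝ) • (((⟨(2 * (k : ℝ)) • 1, smul_one_mem_symOp V _⟩ : symOp V) : V →L[ℝ] V)))
      = (2 * (m * k : ℝ)) • (1 : V →L[ℝ] V) by rw [smul_smul]; ring_nf, ← chirpCLM_eq_chirpQ] at h1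
  have h2 : (-(⟨(2 * (k : ℝ)) • 1, smul_one_mem_symOp V _⟩ : symOp V)) =
      ⟨(-(2 * (k : ℝ))) • 1, smul_one_mem_symOp V _⟩ := Subtype.ext (by simp only [Submodule.coe_neg, neg_smul])
  rw [h1, Heis.unip_eq_unipQ, h2]

end Parabolic

end SchwartzWeil
end HodgeCM

end
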